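/-
Origin: expansion seat `planner-pub-hodgecm-prl1-g3-0`, handover #6 2026-08-18T06:10:14Z (`HOME/pub-hodgecm-prl1-g3/lean/Prl1g3/DiracSequence.lean`, md5 6c30c27d, 209 lines);
landed by the gen-6 packager in gate run 24 as `HodgeCM/Automorphic/DiracSequence.lean` (import ^import Prl1g3\.→import HodgeCM.Automorphic. ×1).
-/
/-
Copyright: HodgeCMPerL adjudication package. WIP seat prl1-g3 (planner-pub-hodgecm-prl1-g3-0), file 6.
-/
import Summits.HodgeConjecture.HodgeCM.Automorphic.IntegratedRep_2
import Summits.HodgeConjecture.HodgeCM.PerL34.QuotientSmoothingHaar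

/-!
# Existence of Dirac sequences; inversion invariance of Haar measure on unimodular groups

File 5 (`IntegratedRep`) reduced the analytic field `discreteDecomp` of the representation
carrier on the `L²([U(W)])` side to the record `RepCoreCarrier.AnalyticD`, whose field
`dirac_compact : ∃ d : RepDecomp.DiracDatum G, ∀ n, IsCompactOperator (d.opFun C.R n)` bundles

* a *Dirac datum* on `G` (a measure finite on compacts and invariant under inversion, and a
  Dirac sequence for it — Getz–Hahn, *An Introduction to Automorphic Representations* (GTM 300,
  2024) §9.3 p. 179: "let `{fₙ} ⊆ C_c^∞(G(𝔸_F)¹)` be a Dirac sequence. Thus the `fₙ` are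
  nonnegative, and the following conditions hold: (a) For all open neighborhoods `U ∋ 1` with
  compact closure, the support of `fₙ` is contained in `U` for `n` large enough (depending on
  `U`). (b) For all `n`, `fₙ(x⁻¹) = fₙ(x)`. (c) For all `n`, `∫ fₙ(g) dg = 1`. It is not hard
  to see that a Dirac sequence exists (see Exercise 9.7)."), and
* the compactness of the operators `R(fₙ)` (GH Theorem 9.1.1 p. 174).

This file discharges, IN THE KERNEL, the two parts of the datum that GH leave as remarks:

1. `RepDecomp.exists_isDiracSeq` — **Exercise 9.7 solved**: every first countable locally compact
   topological group, with any measure that is positive on open sets and finite on compact sets,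
   carries a Dirac sequence in the sense of `RepDecomp.IsDiracSeq` (continuous, compactly
   supported, nonnegative, (a), (b), (c)).  Construction: Urysohn functions
   (`exists_continuous_one_zero_of_isCompact`) supported in a shrinking basis of symmetric open
   neighbourhoods of `1`, symmetrised by `g ↦ ψ g + ψ g⁻¹` and normalised by their (positive)
   integrals.  Hence `RepDecomp.DiracDatum.ofMeasure`.
2. `RepDecomp.DiracDatum.ofHaar` — on a *unimodular* locally compact group (a left Haar measure that is
   also right invariant) a regular Haar measure is invariant under `g ↦ g⁻¹`; this is ALREADY IN THE TREE as
   `HodgeCM.PerL34.QuotientSmoothing.isInvInvariant_of_isMulRightInvariant` (seat pv06-g2, gate run 22,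
   `HodgeCM/PerL34/QuotientSmoothingHaar.lean`) and is used here BY NAME, not re-proved.  The print input
   this leaves to the model is unimodularity of `U(W)(𝔸)` — GH Lemma 3.5.4 p. 62 (reductive groups over the
   adeles are unimodular) — supplied as the instance `IsMulRightInvariant`.
3. `RepDecomp.IsDiracSeq.isApproxIdentity` — on a locally compact group a Dirac sequence in the sense of
   file 5 is an approximate identity in the sense of `HodgeCM.PerL34.ApproxIdentity.IsApproxIdentity`
   (seat pv06, gate run 21), so that tree's `smOp_tendsto` / `smOp_mem_of_invariant` apply to it as well
   (the two seats' integrated operators agree pointwise: `RepDecomp.DiracDatum.opFun_eq_smOp`).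

Net effect on `RepCoreCarrier.AnalyticD.dirac_compact`: for a first countable locally compact
Hausdorff-regular topological group with a regular Haar measure that is right invariant, the
Dirac datum is `DiracDatum.ofHaar G μ` (no choices left to justify in prose), and the ONLY
remaining cited theorem in that field is the compactness of `R(fₙ)` (GH Theorem 9.1.1).

Kernel-checked throughout, no new axioms; imports `Mathlib.*` / this seat's files only.
-/

open scoped Topology ENNReal
open MeasureTheory Filter Set

namespace HodgeCM
namespace RepDecomp

section DiracExistence

variable {G : Type*} [Group G] [TopologicalSpace G] [IsTopologicalGroup G]
variable [MeasurableSpace G] [OpensMeasurableSpace G]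
variable (ν : Measure G) [IsFiniteMeasureOnCompacts ν] [ν.IsOpenPosMeasure]

/-- **Dirac sequences exist** (GH §9.3 p. 179, Exercise 9.7), for any measure positive on open
sets and finite on compact sets on a first countable locally compact topological group. -/
theorem exists_isDiracSeq [LocallyCompactSpace G] [FirstCountableTopology G] :
    ∃ φ : ℕ → G → ℝ, IsDiracSeq ν φ := by
  classical
  obtain ⟨u, hu⟩ := (𝓝 (1 : G)).exists_antitone_basis
  -- symmetric open neighbourhoods of `1` inside `u n`
  let O : ℕ → Set G := fun n => interior (u n) ∩ (interior (u n))⁻¹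
  have hOopen : ∀ n, IsOpen (O n) := fun n => isOpen_interior.inter isOpen_interior.inv
  have hO1 : ∀ n, (1 : G) ∈ O n := fun n => by
    have h1 : (1 : G) ∈ interior (u n) :=
      mem_interior_iff_mem_nhds.mpr (hu.1.mem_of_mem trivial)
    exact ⟨h1, by rw [Set.mem_inv, inv_one]; exact h1⟩
  have hOsymm : ∀ n g, g ∈ O n → g⁻¹ ∈ O n := fun n g hg =>
    ⟨Set.mem_inv.mp hg.2, by rw [Set.mem_inv, inv_inv]; exact hg.1⟩
  have hOu : ∀ n, O n ⊆ u n := fun n => Set.inter_subset_left.trans interior_subset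
  -- Urysohn functions: `1` at the identity, `0` off `O n`
  have hψ : ∀ n, ∃ f : C(G, ℝ), EqOn f 1 {1} ∧ EqOn f 0 (O n)ᶜ ∧ HasCompactSupport f ∧
      ∀ x, f x ∈ Icc (0 : ℝ) 1 := fun n =>
    exists_continuous_one_zero_of_isCompact isCompact_singleton (hOopen n).isClosed_compl
      (Set.disjoint_singleton_left.mpr fun h => h (hO1 n))
  choose ψ hψ1 hψ0 hψc hψI using hψ
  -- symmetrisation
  let F : ℕ → G → ℝ := fun n g => ψ n g + ψ n g⁻¹
  have hFc : ∀ n, Continuous (F n) := fun n =>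
    (ψ n).continuous.add ((ψ n).continuous.comp continuous_inv)
  have hFcs : ∀ n, HasCompactSupport (F n) := fun n =>
    (hψc n).add ((hψc n).comp_homeomorph (Homeomorph.inv G))
  have hFnn : ∀ n, 0 ≤ F n := fun n g => add_nonneg (hψI n g).1 (hψI n g⁻¹).1
  have hF1 : ∀ n, F n 1 ≠ 0 := fun n => by
    have h : ψ n 1 = 1 := hψ1 n rfl
    simp only [F, inv_one, h]
    norm_num
  have hFpos : ∀ n, 0 < ∫ g, F n g ∂ν := fun n =>
    (hFc n).integral_pos_of_hasCompactSupport_nonneg_nonzero (hFcs n) (hFnn n) (hF1 n)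
  have hFsupp : ∀ n g, F n g ≠ 0 → g ∈ O n := fun n g hg => by
    by_contra hgO
    have h1 : ψ n g = 0 := hψ0 n hgO
    have h2 : ψ n g⁻¹ = 0 := hψ0 n fun h => hgO (by simpa using hOsymm n _ h)
    exact hg (by simp only [F, h1, h2, add_zero])
  -- normalisation
  refine ⟨fun n g => (∫ x, F n x ∂ν)⁻¹ * F n g, ⟨?_, ?_, ?_, ?_, ?_, ?_⟩⟩
  · exact fun n => continuous_const.mul (hFc n)
  · exact fun n => (hFcs n).mul_left
  · exact fun n g => mul_nonneg (inv_nonneg.mpr (hFpos n).le) (hFnn n g)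
  · intro U hUo hU1 _
    filter_upwards [hu.eventually_subset (hUo.mem_nhds hU1)] with n hn
    intro g hg
    rw [Function.mem_support, mul_ne_zero_iff] at hg
    exact hn (hOu n (hFsupp n g hg.2))
  · intro n g
    simp only [F, inv_inv, add_comm]
  · intro n
    rw [integral_const_mul, inv_mul_cancel₀ (hFpos n).ne']

end DiracExistence

namespace DiracDatum

/-- The Dirac datum of a first countable locally compact topological group with a Borel measure
that is finite on compacts, positive on opens and invariant under inversion: the Dirac sequence is
the one constructed in `exists_isDiracSeq` (GH Exercise 9.7, now a theorem). -/
noncomputable def ofMeasure (G : Type*) [Group G] [TopologicalSpace G] [IsTopologicalGroup G]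
    [LocallyCompactSpace G] [FirstCountableTopology G] [MeasurableSpace G] [BorelSpace G]
    (ν : Measure G) [IsFiniteMeasureOnCompacts ν] [ν.IsOpenPosMeasure] [ν.IsInvInvariant] :
    DiracDatum G where
  ν := ν
  φ := Classical.choose (exists_isDiracSeq ν)
  dirac := Classical.choose_spec (exists_isDiracSeq ν)

/-- (Ported verbatim from the HodgeCMPerL package; no docstring in the source.) -/
@[simp] theorem ofMeasure_ν (G : Type*) [Group G] [TopologicalSpace G] [IsTopologicalGroup G]
    [LocallyCompactSpace G] [FirstCountableTopology G] [MeasurableSpace G] [BorelSpace G]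
    (ν : Measure G) [IsFiniteMeasureOnCompacts ν] [ν.IsOpenPosMeasure] [ν.IsInvInvariant] :
    (ofMeasure G ν).ν = ν := rfl

end DiracDatum

section Unimodular

variable {G : Type*} [Group G] [TopologicalSpace G] [IsTopologicalGroup G]
  [MeasurableSpace G] [BorelSpace G] (μ : Measure G) [μ.IsHaarMeasure]

/-- The **Dirac datum of a unimodular group**: a first countable locally compact topological group with
a regular Haar measure that is also right invariant (inversion invariance by the in-tree
`HodgeCM.PerL34.QuotientSmoothing.isInvInvariant_of_isMulRightInvariant`). -/
noncomputable def DiracDatum.ofHaar (G : Type*) [Group G] [TopologicalSpace G]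
    [IsTopologicalGroup G] [LocallyCompactSpace G] [FirstCountableTopology G] [MeasurableSpace G]
    [BorelSpace G] (μ : Measure G) [μ.IsHaarMeasure] [μ.Regular] [μ.IsMulRightInvariant] :
    DiracDatum G :=
  haveI := HodgeCM.PerL34.QuotientSmoothing.isInvInvariant_of_isMulRightInvariant μ
  DiracDatum.ofMeasure G μ

/-- (Ported verbatim from the HodgeCMPerL package; no docstring in the source.) -/
@[simp] theorem DiracDatum.ofHaar_ν (G : Type*) [Group G] [TopologicalSpace G]
    [IsTopologicalGroup G] [LocallyCompactSpace G] [FirstCountableTopology G] [MeasurableSpace G]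
    [BorelSpace G] (μ : Measure G) [μ.IsHaarMeasure] [μ.Regular] [μ.IsMulRightInvariant] :
    (DiracDatum.ofHaar G μ).ν = μ := rfl

end Unimodular


/-! ## Bridge to `HodgeCM.PerL34.ApproxIdentity` (seat pv06) -/
section Bridge

variable {G : Type*} [Group G] [TopologicalSpace G]
variable [MeasurableSpace G] [OpensMeasurableSpace G] {ν : Measure G} [IsFiniteMeasureOnCompacts ν]

omit [OpensMeasurableSpace G] [IsFiniteMeasureOnCompacts ν] in
/-- On a locally compact group a Dirac sequence is an approximate identity in pv06's sense (condition (a)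
there is asked for every neighbourhood of `1`; every neighbourhood contains an open one with compact
closure). -/
theorem IsDiracSeq.isApproxIdentity [LocallyCompactSpace G] [R1Space G] {φ : ℕ → G → ℝ}
    (hφ : IsDiracSeq ν φ) : HodgeCM.PerL34.ApproxIdentity.IsApproxIdentity ν φ where
  cont := hφ.cont
  cpt := hφ.cptSupport
  nonneg := hφ.nonneg
  integral_one := hφ.integral_one
  small U hU := by
    obtain ⟨K, hK, hK1⟩ := exists_compact_mem_nhds (1 : G)
    have hW : interior (K ∩ U) ∈ 𝓝 (1 : G) := interior_mem_nhds.mpr (Filter.inter_mem hK1 hU)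
    have h1 : (1 : G) ∈ interior (K ∩ U) := mem_of_mem_nhds hW
    have hc : IsCompact (closure (interior (K ∩ U))) :=
      hK.closure_of_subset (interior_subset.trans Set.inter_subset_left)
    filter_upwards [hφ.support_small _ isOpen_interior h1 hc] with n hn
    exact hn.trans (interior_subset.trans Set.inter_subset_right)

end Bridge

section Bridge2

variable {G : Type*} [Group G] [TopologicalSpace G]
variable {H : Type*} [NormedAddCommGroup H] [InnerProductSpace ℂ H]

/-- The two seats' integrated operators agree: `DiracDatum.opFun` (this seat, a bare function) is pv06's
`ApproxIdentity.smOp` (a bounded operator, for a representation bounded by `c` with continuous orbit maps). -/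
theorem DiracDatum.opFun_eq_smOp (d : DiracDatum G) (R : G →* (H →L[ℂ] H))
    (hRc : ∀ v : H, Continuous fun g => R g v) (c : ℝ) (hRb : ∀ g, ‖R g‖ ≤ c) (n : ℕ) :
    letI := d.mG; letI := d.opensG; letI := d.finCpt
    d.opFun R n = ⇑(HodgeCM.PerL34.ApproxIdentity.smOp d.ν R hRc c hRb (d.φ n) (d.dirac.cont n)
      (d.dirac.cptSupport n)) := by
  funext v
  rfl

end Bridge2


end RepDecomp
end HodgeCM
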